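import Literature.NumberTheory.LFunctions.FeketePolyaKernelSignTablesTwist
import HarnessLib

/-!
# Packed sign tables with a bounded spreading chunk (for wide digits) and the plain tables of each conductor kind

Topic `Literature/NumberTheory/LFunctions`; namespace `Literature.NumberTheory.LFunctions.FeketePolyaKernel`
(sequel of `FeketePolyaKernelSignTablesTwist.lean`). Small computable definitions and THEOREMS (no named fact, no
`sorry`). `FeketePolyaKernelSignTables.qrPlus b p` spreads the quadratic-residue bitset in chunks of `b − 1` bits,
whose spreading multiplier has `≈ b²` bits — fine for digit widths `b ≲ 200`, but the DILATED tables of the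
reweighted certificates (`FeketePolyaKernelCertificatesWeighted.lean`) live at digit width `b·d` with `d` up to a
few hundred, where that multiplier would exceed the kernel's native range for `2 ^ N` (`N < 2^24`). Here the chunk
size is a parameter `c` (`qrPlusC`, `qrMinusC`, `jacTabsC`, `isSignTab_qrC`, `isSignTab_jacTabsC` — the proofs of
the previous files verbatim with `c` for `b − 1`), and `plainTabsC kind b c ps N` / `plainVal kind` package the four
conductor kinds (`q` odd, `4m`, `8m` with either pattern) WITHOUT the inducing mask (`isSignTab_plainTabsC`).

## References

* H. L. Montgomery, R. C. Vaughan, *Multiplicative Number Theory I*, CUP 2007, §9.3 Thm 9.13. [MontgomeryVaughan2007]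
* J. von zur Gathen, J. Gerhard, *Modern Computer Algebra*, 3rd ed., CUP 2013, §8.4. [GathenGerhard2013ModernComputerAlgebra]
-/

namespace Literature.NumberTheory.LFunctions

namespace FeketePolyaKernel

open Finset Literature.Analysis.Convolution FeketePolyaTable
open scoped NumberTheorySymbols

/-! ### Residue tables with chunk parameter -/

/-- Digits `1 ≤ r < p` that are squares mod `p`: the bitset `sqBits p (p − 1)` spread to base-`2^b` digits in
CHUNKS OF `c` BITS (`1 ≤ c ≤ b − 1`; a bounded `c` keeps the spreading multiplier small when the digit width `b` is
large, as for the dilated tables of reweighted streams), digit `0` and digits `≥ p` cleared. [cite: MontgomeryVaughan2007, §9.3] -/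
def qrPlusC (b c p : ℕ) : ℕ :=
  spreadBits b c (sqBits p (p - 1)) ((p + c - 1) / c + 1) &&& (onesS b p - 1)

/-- Digits `1 ≤ r < p` that are NOT squares mod `p` (chunked spreading). [cite: MontgomeryVaughan2007, §9.3] -/
def qrMinusC (b c p : ℕ) : ℕ := (onesS b p - 1) - qrPlusC b c p

/-- `Nat.beq j 0 = false` for `j ≠ 0`. [folklore] -/
private theorem beq_false_of_ne' {j : ℕ} (h : j ≠ 0) : Nat.beq j 0 = false := by
  cases hj : Nat.beq j 0
  · rfl
  · exact absurd (Nat.eq_of_beq_eq_true hj) h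

/-- `onesV b p − 1 = kpack b p (r ↦ [r ≠ 0])` (`p ≥ 1`). [folklore] -/
private theorem onesV_sub_one' {b p : ℕ} (hb : 1 ≤ b) (hp : 1 ≤ p) :
    onesV b p - 1 = kpack b p fun r => ind (r ≠ 0) := by
  have h1 : (kpack b p fun r => ind (r = 0)) = 1 := by
    obtain ⟨p', rfl⟩ : ∃ p', p = 1 + p' := ⟨p - 1, by omega⟩
    rw [kpack_extend (d := fun r => ind (r = 0)) (fun j _ => rfl) (fun j hj _ => by simp [ind]; omega)]
    simp [ind]
  have h2 : (kpack b p fun r => ind (r = 0)) + (kpack b p fun r => ind (r ≠ 0)) = kpack b p fun _ => 1 := by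
    rw [kpack_add_kpack]
    exact kpack_congr fun j _ => by by_cases h : j = 0 <;> simp [ind, h]
  rw [onesV_eq_kpack hb]
  omega

/-- **The residue tables are the sign tables of `legVal`** (`b ≥ 2`, `1 ≤ c ≤ b − 1`, `p ≥ 1`): digit `r` of `qrPlusC b c p` is
`[legVal p B r = 1]`, of `qrMinusC b c p` is `[legVal p B r = −1]`, `B = sqBits p (p − 1)` — by the very definition of
`legVal` (bit `r` of `B`, and `0` at `r = 0`); with `legVal_eq` these are `[(r/p) = ±1]` for a prime `p`.
[cite: MontgomeryVaughan2007, §9.3] -/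
theorem isSignTab_qrC {b c p : ℕ} (hb : 2 ≤ b) (hc1 : 1 ≤ c) (hc : c ≤ b - 1) (hp : 1 ≤ p) :
    IsSignTab b p (fun n => legVal p (sqBits p (p - 1)) n) (qrPlusC b c p, qrMinusC b c p) := by
  set B := sqBits p (p - 1) with hB
  set I := (p + c - 1) / c + 1 with hI
  have hb1 : 1 ≤ b := by omega
  have hpI : p ≤ c * I := by
    have := Nat.lt_div_mul_add (a := p + c - 1) hc1
    rw [hI, Nat.mul_add, Nat.mul_one, Nat.mul_comm]
    omega
  -- the spread bitset as a vector of `p` digits extended by zeros (digits ≥ p are masked anyway)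
  have hspread := spreadBits_eq (A := B) hb hc I
  -- the mask, extended by zero digits to the length of the spread vector
  obtain ⟨r, hr⟩ : ∃ r, c * I = p + r := ⟨c * I - p, by omega⟩
  have hmask : onesV b p - 1 = kpack b (c * I) fun j => if j < p then ind (j ≠ 0) else 0 := by
    rw [onesV_sub_one' hb1 hp, hr]
    exact (kpack_extend (fun j hj => by simp [hj]) (fun j hj _ => by simp [not_lt.2 hj])).symm
  have hbit : ∀ j < c * I, (fun r => (B.testBit r).toNat) j < 2 ^ b := fun j _ =>
    (Bool.toNat_le _).trans_lt (Nat.one_lt_two_pow (by omega))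
  have hmk : ∀ j < c * I, (fun j => if j < p then ind (j ≠ 0) else 0) j < 2 ^ b := fun j _ => by
    dsimp only
    split_ifs
    · exact ind_lt _ hb1
    · positivity
  have hplus : qrPlusC b c p = kpack b p fun n => ind (legVal p B n = 1) := by
    rw [qrPlusC, onesS_eq, ← hB, hspread, hmask, kpack_land (by omega) hbit hmk, hr]
    refine kpack_extend (fun j hj => ?_) (fun j hj _ => by simp [not_lt.2 hj])
    simp only [if_pos hj, legVal, Nat.mod_eq_of_lt hj]
    by_cases hj0 : j = 0
    · simp [hj0, ind]
    · have : Nat.beq j 0 = false := beq_false_of_ne' hj0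
      cases hBj : B.testBit j <;> simp [this, ind, hj0]
  refine ⟨hplus, ?_⟩
  show qrMinusC b c p = _
  rw [qrMinusC, onesS_eq, hplus, onesV_sub_one' hb1 hp, kpack_tsub fun j _ => ?_]
  · refine kpack_congr fun j hj => ?_
    simp only [legVal, Nat.mod_eq_of_lt hj]
    by_cases hj0 : j = 0
    · simp [hj0, ind]
    · have : Nat.beq j 0 = false := beq_false_of_ne' hj0
      cases hBj : B.testBit j <;> simp [this, ind, hj0]
  · by_cases hj0 : j = 0
    · subst hj0; simp [ind, legVal]
    · simp only [ind, if_pos hj0]; split_ifs <;> omega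

/-! ### Jacobi tables and the plain tables of each kind -/

/-- Sign tables of `n ↦ jacVal (resTable ps) n` over `Q` slots, chunked spreading (chunk `c`). [cite: MontgomeryVaughan2007, §9.3 Theorem 9.13] -/
def jacTabsC (b c Q : ℕ) : List ℕ → ℕ × ℕ
  | [] => (onesS b Q, 0)
  | p :: rest =>
    match jacTabsC b c Q rest with
    | (P, M) => mulTab P M (pextS b p (Q / p) (qrPlusC b c p)) (pextS b p (Q / p) (qrMinusC b c p))

/-- **`jacTabsC` are the sign tables of `jacVal (resTable ps)`** over `Q` slots (chunked spreading). [cite: MontgomeryVaughan2007, §9.3 Theorem 9.13] -/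
theorem isSignTab_jacTabsC {b c Q : ℕ} (hb : 2 ≤ b) (hc1 : 1 ≤ c) (hc : c ≤ b - 1) :
    ∀ ps : List ℕ, (∀ p ∈ ps, 1 ≤ p ∧ p ∣ Q) → IsSignTab b Q (fun n => jacVal (resTable ps) n) (jacTabsC b c Q ps)
  | [], _ => by
    refine ⟨?_, ?_⟩
    · show onesS b Q = _
      rw [onesS_eq, onesV_eq_kpack (by omega)]
      exact kpack_congr fun n _ => by simp [resTable, jacVal, ind]
    · show (0 : ℕ) = _
      rw [← kpack_zero_fun b Q]
      exact kpack_congr fun n _ => by simp [resTable, jacVal, ind]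
  | p :: rest, hps => by
    have hp := hps p (by simp)
    have ih := isSignTab_jacTabsC hb hc1 hc rest fun p' hp' => hps p' (by simp [hp'])
    have hq := isSignTab_pext (N := Q) (by omega) hp.1 hp.2 (isSignTab_qrC hb hc1 hc hp.1)
      (fun s => by simp only [legVal, Nat.mod_mod])
    rw [jacTabsC]
    split
    next P M hPM =>
      rw [hPM] at ih
      refine (isSignTab_mulTab (by omega) ih hq (val3_jacVal _) (val3_legVal _ _)).congr fun n _ => ?_
      show jacVal (resTable rest) n * legVal p (sqBits p (p - 1)) n =
        jacVal ((p, sqBits p (p - 1)) :: resTable rest) n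
      rw [jacVal, mul_comm]

/-- Plain sign tables of the primitive quadratic character of conductor `q = ∏ ps` (kind `0`), `4·∏ ps` (kind
`1`), `8·∏ ps` pattern `χ₋₈` (kind `2`) / `χ₈` (kind `3`), over `N` slots at digit width `b`, spreading chunk `c`,
no inducing mask (pattern tables written with shifts: `2 ^ N` is evaluated natively only for `N < 2^24`).
[cite: MontgomeryVaughan2007, §9.3 Theorem 9.13] -/
def plainTabsC (kind b c : ℕ) (ps : List ℕ) (N : ℕ) : ℕ × ℕ :=
  match kind with
  | 0 => jacTabsC b c N ps
  | 1 => twistTabs b N 4 (1 <<< b) (1 <<< (3 * b)) (jacTabsC b c N ps)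
  | 2 => twistTabs b N 8 ((1 <<< b) + (1 <<< (3 * b))) ((1 <<< (5 * b)) + (1 <<< (7 * b))) (jacTabsC b c N ps)
  | _ => twistTabs b N 8 ((1 <<< b) + (1 <<< (7 * b))) ((1 <<< (3 * b)) + (1 <<< (5 * b))) (jacTabsC b c N ps)

/-- The value function of each kind from a residue table. [cite: MontgomeryVaughan2007, §9.3 Theorem 9.13] -/
def plainVal (kind : ℕ) (tbl : List (ℕ × ℕ)) (n : ℕ) : ℤ :=
  match kind with
  | 0 => valOddR tbl n
  | 1 => valFourR tbl n
  | 2 => valEightAR tbl n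
  | _ => valEightBR tbl n

/-- `plainVal` takes values in `{0, 1, −1}`. [cite: MontgomeryVaughan2007, §9.3 Theorem 9.13] -/
theorem val3_plainVal (kind : ℕ) (tbl : List (ℕ × ℕ)) (n : ℕ) : Val3 (plainVal kind tbl n) := by
  have hj := val3_jacVal tbl n
  have hmul : ∀ e y : ℤ, Val3 e → Val3 y → Val3 (e * y) := fun e y he hy => by
    rcases he with h | h | h <;> rcases hy with h' | h' | h' <;> simp [Val3, h, h']
  unfold plainVal
  split
  · exact hj
  · exact hmul _ _ (val3_tableVal_four n).1 hj
  · exact hmul _ _ (val3_tableVal_eightA n).1 hj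
  · exact hmul _ _ (val3_tableVal_eightB n).1 hj

/-- The period of the `2`-part pattern of each kind (`1`, `4`, `8`, `8`). [cite: MontgomeryVaughan2007, §9.3 Theorem 9.13] -/
def kindPeriod (kind : ℕ) : ℕ :=
  match kind with
  | 0 => 1
  | 1 => 4
  | _ => 8

/-- **`plainTabs` (chunked) are the sign tables of `plainVal`** over `N` slots (`b ≥ 2`; all `p ∈ ps` are `≥ 1` and divide
`N`; the pattern period divides `N`). [cite: MontgomeryVaughan2007, §9.3 Theorem 9.13] -/
theorem isSignTab_plainTabsC {kind b c N : ℕ} (hb : 2 ≤ b) (hc1 : 1 ≤ c) (hc : c ≤ b - 1) (ps : List ℕ)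
    (hps : ∀ p ∈ ps, 1 ≤ p ∧ p ∣ N) (hper : kindPeriod kind ∣ N) :
    IsSignTab b N (plainVal kind (resTable ps)) (plainTabsC kind b c ps N) := by
  have hj := isSignTab_jacTabsC (Q := N) hb hc1 hc ps hps
  unfold plainTabsC
  simp only [Nat.one_shiftLeft]
  match kind, hper with
  | 0, _ => exact hj
  | 1, h4 =>
    exact isSignTab_twistTabs (by omega) (by norm_num) (show 4 ∣ N from h4) hj (isSignTab_four b)
      (fun s => tableVal_mod_length [0, 1, 0, -1] s) (val3_jacVal _) fun n => (val3_tableVal_four n).1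
  | 2, h8 =>
    exact isSignTab_twistTabs (by omega) (by norm_num) (show 8 ∣ N from h8) hj (isSignTab_eightA b)
      (fun s => tableVal_mod_length [0, 1, 0, 1, 0, -1, 0, -1] s) (val3_jacVal _) fun n => (val3_tableVal_eightA n).1
  | k + 3, h8 =>
    exact isSignTab_twistTabs (by omega) (by norm_num) (show 8 ∣ N from h8) hj (isSignTab_eightB b)
      (fun s => tableVal_mod_length [0, 1, 0, -1, 0, -1, 0, 1] s) (val3_jacVal _) fun n => (val3_tableVal_eightB n).1

end FeketePolyaKernel

end Literature.NumberTheory.LFunctions
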